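import Mathlib
import HarnessLib
import Literature.Geometry.DiscreteGeometry.KissingPatterns
import Literature.Geometry.DiscreteGeometry.FlyspeckL12
import Literature.Geometry.DiscreteGeometry.FejesTothKissingTwelve

/-!
# Quasi-twelve-neighbour geometry from Flyspeck `L12` — part 1 of 2 of the proof of `ContactSaturationLadder.TightSomewhereRung`
# (route ContactSaturationLadder, item stmt-AtomisticToContinuum-30305; decomposition cell decomp-a2c, lens-1)

Pure discrete geometry, no summit-side imports; consumed by `ContactSaturationLadderTightSomewhereRungRigidity.lean` (part 2), which proves
the registered stub `stub_rigidityFromFlyspeck` of item 30305 and composes the tree item `TightSomewhereRung` from the two NAMED FACTS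
`Literature.Geometry.DiscreteGeometry.flyspeck_L12` and `Literature.Geometry.DiscreteGeometry.Hales2012_kissingConfigCongruent`.
(Split of the single 634-line evidence file of 2026-08-29 at the gate's 400-line limit; content unchanged, made DEFINITION-FREE — the near set and the
quasi-kissing predicate are kept inline; §W proves the registered stubs `stub_twelveGap` / `stub_kissingCompactness` of item 30305's
skeleton v2 `TightSomewhereRung_line_v2.lean` BY NAME.)

* §A RUNG G (EFFECTIVE, δ < 1/50) `twelve_gap`: if `y v` has ≥ 12 other points within `(1+δ)d` and all pairs within `1.26·d` of `y v` are
  `≥ d` apart, then it has EXACTLY twelve, and every other point is either within `(1+δ)d` or beyond `(1.26 − 12δ)·d` — rescale by `2/d`,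
  apply `L12` (`∑ L(h) ≤ 12`, `L` affine, `L(1)=1`, `L(1.26)=0`) to the twelve near points plus the intruder.
* §B RUNG P (INEFFECTIVE, compactness) `kissing_compactness`: for every ε > 0 there is δ₁ > 0 such that every δ₁-quasi-kissing twelve-tuple
  (norms in `[2, 2+2δ]`, pair distances `≥ 2` and in `[2, 2+2δ] ∪ [2.52 − 24δ, ∞)`) is ε-close, index by index, to an injective tuple whose
  range is a kissing configuration in Hales's class — Bolzano–Weierstrass in `Fin 12 → ℝ³` on a sequence of counterexamples; the limit is a
  genuine kissing configuration (`kissing_of_limit`).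
* §C `etaMatched_of_tuples`: matched tuples give `ShellCloseTo`-style matched finite sets.
-/

open scoped BigOperators Topology
open Filter
open Literature.Geometry.DiscreteGeometry

namespace Summit.AtomisticToContinuum.Crystallization.Theorems.ContactSaturationLadderQuasiTwelve

/-! ## §A  The L12 gap: a δ-twelve-coordinated centre has exactly twelve near points and an annular gap -/

/-- Hales's constant `h₀ = 1.26`. -/
theorem hales_h0_val : hales_h0 = 63 / 50 := by
  rw [hales_h0_eq]; norm_num

/-- Hales's affine weight `L(h) = (h₀ − h)/(h₀ − 1)` in closed form. -/
theorem halesL_eq (h : ℝ) : halesL h = (63 / 50 - h) / (13 / 50) := by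
  rw [halesL_apply, hales_h0_val]; norm_num

/-- `L` is antitone. -/
theorem halesL_antitone {a b : ℝ} (hab : a ≤ b) : halesL b ≤ halesL a := by
  rw [halesL_eq, halesL_eq]
  apply div_le_div_of_nonneg_right _ (by norm_num)
  linarith

/-- Membership in the near set `{l ≠ v : dist (y l) (y v) ≤ r}` (a `Finset.filter`; kept definition-free). -/
theorem mem_nearSet {N : ℕ} {y : Fin N → EuclideanSpace ℝ (Fin 3)} {v l : Fin N} {r : ℝ} :
    l ∈ (Finset.univ.filter fun l => l ≠ v ∧ dist (y l) (y v) ≤ r) ↔ l ≠ v ∧ dist (y l) (y v) ≤ r := by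
  simp

/-- Core L12 estimate: twelve points within `(1+δ)d` of `y v` plus one more point `w` within
`1.26 d` force `dist (y w) (y v) ≥ (1.26 - 12δ) d`. -/
theorem gap_of_twelve (hL12 : flyspeck_L12) {N : ℕ} (y : Fin N → EuclideanSpace ℝ (Fin 3))
    (v : Fin N) {d δ : ℝ} (hd : 0 < d) (hδ0 : 0 ≤ δ) (hδ : δ ≤ 13 / 50)
    (hsep : ∀ k l : Fin N, k ≠ l → dist (y k) (y v) ≤ 63 / 50 * d →
      dist (y l) (y v) ≤ 63 / 50 * d → d ≤ dist (y k) (y l))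
    (S₀ : Finset (Fin N)) (hS₀ : S₀ ⊆ (Finset.univ.filter fun l => l ≠ v ∧ dist (y l) (y v) ≤ (1 + δ) * d)) (hcard : S₀.card = 12)
    (w : Fin N) (hwv : w ≠ v) (hwS : w ∉ S₀) (hw : dist (y w) (y v) ≤ 63 / 50 * d) :
    (63 / 50 - 12 * δ) * d ≤ dist (y w) (y v) := by
  -- the rescaled thirteen-point configuration
  set φ : Fin N → EuclideanSpace ℝ (Fin 3) := fun l => (2 / d) • (y l - y v) with hφ
  have hd0 : d ≠ 0 := hd.ne'
  have h2d : (0 : ℝ) < 2 / d := by positivity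
  have hnorm : ∀ l, ‖φ l‖ = 2 / d * dist (y l) (y v) := by
    intro l
    rw [hφ]
    simp only [norm_smul, Real.norm_eq_abs, abs_of_pos h2d, dist_eq_norm]
  have hdistφ : ∀ k l, dist (φ k) (φ l) = 2 / d * dist (y k) (y l) := by
    intro k l
    rw [hφ]
    simp only [dist_smul₀, Real.norm_eq_abs, abs_of_pos h2d]
    congr 1
    rw [dist_eq_norm, dist_eq_norm]
    congr 1
    abel
  -- members of `insert w S₀` are within 1.26 d of y v and distinct from v
  have hmem : ∀ l ∈ insert w S₀, l ≠ v ∧ dist (y l) (y v) ≤ 63 / 50 * d := by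
    intro l hl
    rcases Finset.mem_insert.1 hl with rfl | hl
    · exact ⟨hwv, hw⟩
    · have := mem_nearSet.1 (hS₀ hl)
      refine ⟨this.1, this.2.trans ?_⟩
      nlinarith
  have hinj : Set.InjOn φ ↑(insert w S₀) := by
    intro k hk l hl hkl
    by_contra hne
    have h1 := hmem k hk
    have h2 := hmem l hl
    have hdk := hsep k l hne h1.2 h2.2
    have : dist (φ k) (φ l) = 0 := by rw [hkl, dist_self]
    rw [hdistφ] at this
    have : dist (y k) (y l) = 0 := by
      rcases mul_eq_zero.1 this with h | h
      · exact absurd h h2d.ne'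
      · exact h
    linarith
  set V : Finset (EuclideanSpace ℝ (Fin 3)) := (insert w S₀).image φ with hV
  have hVsep : ∀ p ∈ V, ∀ q ∈ V, p ≠ q → 2 ≤ dist p q := by
    intro p hp q hq hpq
    rw [hV, Finset.mem_image] at hp hq
    obtain ⟨k, hk, rfl⟩ := hp
    obtain ⟨l, hl, rfl⟩ := hq
    have hkl : k ≠ l := fun h => hpq (by rw [h])
    rw [hdistφ]
    have := hsep k l hkl (hmem k hk).2 (hmem l hl).2
    calc (2 : ℝ) = 2 / d * d := by field_simp
      _ ≤ 2 / d * dist (y k) (y l) := by gcongr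
  have hVann : ∀ p ∈ V, 2 ≤ ‖p‖ ∧ ‖p‖ ≤ 2 * hales_h0 := by
    intro p hp
    rw [hV, Finset.mem_image] at hp
    obtain ⟨l, hl, rfl⟩ := hp
    rw [hnorm, hales_h0_val]
    obtain ⟨hlv, hld⟩ := hmem l hl
    have hdl := hsep l v hlv hld (by rw [dist_self]; positivity)
    constructor
    · calc (2 : ℝ) = 2 / d * d := by field_simp
        _ ≤ 2 / d * dist (y l) (y v) := by gcongr
    · calc 2 / d * dist (y l) (y v) ≤ 2 / d * (63 / 50 * d) := by gcongr
        _ = 2 * (63 / 50) := by field_simp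
  have hsum := hL12 V hVsep hVann
  -- rewrite the sum over the index set
  rw [hV, Finset.sum_image hinj, Finset.sum_insert hwS] at hsum
  -- each near point contributes ≥ L(1+δ)
  have hnear : ∀ l ∈ S₀, (63 / 50 - (1 + δ)) / (13 / 50) ≤ halesL (‖φ l‖ / 2) := by
    intro l hl
    have hl' := mem_nearSet.1 (hS₀ hl)
    rw [← halesL_eq]
    apply halesL_antitone
    rw [hnorm]
    calc 2 / d * dist (y l) (y v) / 2 = dist (y l) (y v) / d := by field_simp
      _ ≤ (1 + δ) * d / d := by gcongr; exact hl'.2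
      _ = 1 + δ := by field_simp
  have hS₀sum : (12 : ℝ) * ((63 / 50 - (1 + δ)) / (13 / 50)) ≤ ∑ l ∈ S₀, halesL (‖φ l‖ / 2) := by
    have := Finset.card_nsmul_le_sum S₀ (fun l => halesL (‖φ l‖ / 2)) _ hnear
    rw [hcard] at this
    simpa using this
  have hwL : halesL (‖φ w‖ / 2) ≤ 12 - 12 * ((63 / 50 - (1 + δ)) / (13 / 50)) := by linarith
  rw [halesL_eq, hnorm] at hwL
  have hq : 2 / d * dist (y w) (y v) / 2 = dist (y w) (y v) / d := by field_simp
  rw [hq] at hwL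
  rw [div_le_iff₀ (by norm_num : (0:ℝ) < 13 / 50)] at hwL
  have hwL' : 63 / 50 - dist (y w) (y v) / d ≤ 12 * δ := by nlinarith
  have : (63 / 50 - 12 * δ) ≤ dist (y w) (y v) / d := by linarith
  rwa [le_div_iff₀ hd] at this


/-- **Rung G of the door (effective, δ < 1/50).**  If `v` has at least twelve points within `(1+δ)d`
and all pairs within `1.26 d` of `y v` are `d`-separated, then `v` has EXACTLY twelve such points and
every other point is either near (`≤ (1+δ)d`) or beyond the annular gap (`≥ (1.26 − 12δ)d`). -/
theorem twelve_gap (hL12 : flyspeck_L12) {N : ℕ} (y : Fin N → EuclideanSpace ℝ (Fin 3))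
    (v : Fin N) {d δ : ℝ} (hd : 0 < d) (hδ0 : 0 ≤ δ) (hδ : δ < 1 / 50)
    (hsep : ∀ k l : Fin N, k ≠ l → dist (y k) (y v) ≤ 63 / 50 * d →
      dist (y l) (y v) ≤ 63 / 50 * d → d ≤ dist (y k) (y l))
    (h12 : 12 ≤ ((Finset.univ.filter fun l => l ≠ v ∧ dist (y l) (y v) ≤ (1 + δ) * d)).card) :
    ((Finset.univ.filter fun l => l ≠ v ∧ dist (y l) (y v) ≤ (1 + δ) * d)).card = 12 ∧
      ∀ w : Fin N, w ≠ v → dist (y w) (y v) ≤ (1 + δ) * d ∨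
        (63 / 50 - 12 * δ) * d ≤ dist (y w) (y v) := by
  obtain ⟨S₀, hS₀, hcard⟩ := Finset.le_card_iff_exists_subset_card.1 h12
  have hδ' : δ ≤ 13 / 50 := by linarith
  have key := gap_of_twelve hL12 y v hd hδ0 hδ' hsep S₀ hS₀ hcard
  -- exactly twelve
  have hS : S₀ = (Finset.univ.filter fun l => l ≠ v ∧ dist (y l) (y v) ≤ (1 + δ) * d) := by
    by_contra hne
    have hss : S₀ ⊂ (Finset.univ.filter fun l => l ≠ v ∧ dist (y l) (y v) ≤ (1 + δ) * d) := lt_of_le_of_ne hS₀ hne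
    obtain ⟨w, hw, hwS⟩ := Finset.exists_of_ssubset hss
    have hw' := mem_nearSet.1 hw
    have hfar := key w hw'.1 hwS (hw'.2.trans (by nlinarith))
    have : (63 / 50 - 12 * δ) * d ≤ (1 + δ) * d := hfar.trans hw'.2
    have : 63 / 50 - 12 * δ ≤ 1 + δ := le_of_mul_le_mul_right this hd
    linarith
  refine ⟨by rw [← hS, hcard], fun w hwv => ?_⟩
  by_cases hw : w ∈ (Finset.univ.filter fun l => l ≠ v ∧ dist (y l) (y v) ≤ (1 + δ) * d)
  · exact Or.inl (mem_nearSet.1 hw).2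
  · right
    by_cases hfar : dist (y w) (y v) ≤ 63 / 50 * d
    · exact key w hwv (hS ▸ hw) hfar
    · push Not at hfar
      refine le_trans ?_ hfar.le
      have : (63 / 50 - 12 * δ) ≤ 63 / 50 := by linarith
      exact mul_le_mul_of_nonneg_right this hd.le

/-! ## §B  Compactness: δ-quasi-kissing twelve-tuples are close to exact kissing configurations -/

/-- A `δ`-QUASI-KISSING twelve-tuple (Hales's normalisation, radius 2) is a `p : Fin 12 → ℝ³` with norms in
`[2, 2+2δ]`, pairwise distances `≥ 2` and either `≤ 2+2δ` (near) or `≥ 2h₀ − 24δ` (far); the predicate is kept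
INLINE (definition-free file).  Quasi-kissing is monotone in the slack `δ`. -/
theorem quasiKissing_mono {δ δ' : ℝ} (hδ : δ ≤ δ') {p : Fin 12 → EuclideanSpace ℝ (Fin 3)}
    (h : ((∀ i, 2 ≤ ‖p i‖ ∧ ‖p i‖ ≤ 2 + 2 * δ) ∧ ∀ i j, i ≠ j → 2 ≤ dist (p i) (p j) ∧ (dist (p i) (p j) ≤ 2 + 2 * δ ∨ 2 * hales_h0 - 24 * δ ≤ dist (p i) (p j)))) :
    ((∀ i, 2 ≤ ‖p i‖ ∧ ‖p i‖ ≤ 2 + 2 * δ') ∧ ∀ i j, i ≠ j → 2 ≤ dist (p i) (p j) ∧ (dist (p i) (p j) ≤ 2 + 2 * δ' ∨ 2 * hales_h0 - 24 * δ' ≤ dist (p i) (p j))) := by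
  refine ⟨fun i => ⟨(h.1 i).1, (h.1 i).2.trans (by linarith)⟩, fun i j hij => ⟨(h.2 i j hij).1, ?_⟩⟩
  rcases (h.2 i j hij).2 with h' | h'
  · exact Or.inl (h'.trans (by linarith))
  · exact Or.inr (le_trans (by linarith) h')

/-- The limit of a sequence of `δₙ`-quasi-kissing tuples with `δₙ → 0` is an exact kissing
configuration of Hales's class `𝒱` (as an injective tuple). -/
theorem kissing_of_limit {δ : ℕ → ℝ} {p : ℕ → (Fin 12 → EuclideanSpace ℝ (Fin 3))}
    {q : Fin 12 → EuclideanSpace ℝ (Fin 3)}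
    (hp : ∀ n, ((∀ i, 2 ≤ ‖p n i‖ ∧ ‖p n i‖ ≤ 2 + 2 * δ n) ∧ ∀ i j, i ≠ j → 2 ≤ dist (p n i) (p n j) ∧ (dist (p n i) (p n j) ≤ 2 + 2 * δ n ∨ 2 * hales_h0 - 24 * δ n ≤ dist (p n i) (p n j))))
    (hδ : Tendsto δ atTop (𝓝 0))
    (hq : Tendsto p atTop (𝓝 q)) :
    Function.Injective q ∧ IsKissingConfig (Set.range q) := by
  have hqi : ∀ i, Tendsto (fun n => p n i) atTop (𝓝 (q i)) := fun i =>
    (continuous_apply i).continuousAt.tendsto.comp hq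
  have hnorm : ∀ i, ‖q i‖ = 2 := by
    intro i
    have ht : Tendsto (fun n => ‖p n i‖) atTop (𝓝 ‖q i‖) := (hqi i).norm
    have hup : Tendsto (fun n => 2 + 2 * δ n) atTop (𝓝 (2 + 2 * 0)) :=
      tendsto_const_nhds.add (tendsto_const_nhds.mul hδ)
    rw [mul_zero, add_zero] at hup
    apply le_antisymm
    · exact le_of_tendsto_of_tendsto' ht hup fun n => ((hp n).1 i).2
    · exact ge_of_tendsto' ht fun n => ((hp n).1 i).1
  have hdist : ∀ i j, i ≠ j → 2 ≤ dist (q i) (q j) ∧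
      (dist (q i) (q j) = 2 ∨ 2 * hales_h0 ≤ dist (q i) (q j)) := by
    intro i j hij
    have ht : Tendsto (fun n => dist (p n i) (p n j)) atTop (𝓝 (dist (q i) (q j))) :=
      (hqi i).dist (hqi j)
    have hlow : 2 ≤ dist (q i) (q j) := ge_of_tendsto' ht fun n => ((hp n).2 i j hij).1
    refine ⟨hlow, ?_⟩
    by_cases hfr : ∃ᶠ n in atTop, dist (p n i) (p n j) ≤ 2 + 2 * δ n
    · left
      obtain ⟨ψ, hψ, hψP⟩ := extraction_of_frequently_atTop hfr
      have ht' : Tendsto (fun n => dist (p (ψ n) i) (p (ψ n) j)) atTop (𝓝 (dist (q i) (q j))) :=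
        ht.comp hψ.tendsto_atTop
      have hup : Tendsto (fun n => 2 + 2 * δ (ψ n)) atTop (𝓝 (2 + 2 * 0)) :=
        tendsto_const_nhds.add (tendsto_const_nhds.mul (hδ.comp hψ.tendsto_atTop))
      rw [mul_zero, add_zero] at hup
      exact le_antisymm (le_of_tendsto_of_tendsto' ht' hup hψP) hlow
    · right
      rw [Filter.not_frequently] at hfr
      have hev : ∀ᶠ n in atTop, 2 * hales_h0 - 24 * δ n ≤ dist (p n i) (p n j) := by
        filter_upwards [hfr] with n hn
        rcases ((hp n).2 i j hij).2 with h' | h'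
        · exact absurd h' hn
        · exact h'
      have hlo : Tendsto (fun n => 2 * hales_h0 - 24 * δ n) atTop (𝓝 (2 * hales_h0 - 24 * 0)) :=
        tendsto_const_nhds.sub (tendsto_const_nhds.mul hδ)
      rw [mul_zero, sub_zero] at hlo
      exact le_of_tendsto_of_tendsto hlo ht hev
  have hinj : Function.Injective q := by
    intro i j hij
    by_contra hne
    have := (hdist i j hne).1
    rw [hij, dist_self] at this
    linarith
  refine ⟨hinj, ?_, ?_, ?_⟩
  · rw [Set.ncard_range_of_injective hinj, Nat.card_eq_fintype_card, Fintype.card_fin]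
  · rintro x ⟨i, rfl⟩
    exact hnorm i
  · rintro x ⟨i, rfl⟩ y ⟨j, rfl⟩
    by_cases hij : i = j
    · exact Or.inl (by rw [hij])
    · exact Or.inr (hdist i j hij).2

/-- **Rung P of the door (qualitative, by compactness).**  For every `ε > 0` there is `δ > 0` such that
every `δ`-quasi-kissing twelve-tuple is pointwise `ε`-close to an (injective) exact kissing
configuration of Hales's class `𝒱`. -/
theorem kissing_compactness {ε : ℝ} (hε : 0 < ε) :
    ∃ δ : ℝ, 0 < δ ∧ ∀ p : Fin 12 → EuclideanSpace ℝ (Fin 3),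
      ((∀ i, 2 ≤ ‖p i‖ ∧ ‖p i‖ ≤ 2 + 2 * δ) ∧ ∀ i j, i ≠ j → 2 ≤ dist (p i) (p j) ∧ (dist (p i) (p j) ≤ 2 + 2 * δ ∨ 2 * hales_h0 - 24 * δ ≤ dist (p i) (p j))) →
      ∃ q : Fin 12 → EuclideanSpace ℝ (Fin 3), Function.Injective q ∧
        IsKissingConfig (Set.range q) ∧ ∀ i, dist (p i) (q i) ≤ ε := by
  by_contra hcon
  push Not at hcon
  -- a bad δₙ-quasi-kissing tuple for δₙ = 1/(n+1)
  have hδn : ∀ n : ℕ, (0 : ℝ) < 1 / ((n : ℝ) + 1) := fun n => by positivity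
  choose p hpQ hpbad using fun n : ℕ => hcon (1 / ((n : ℝ) + 1)) (hδn n)
  -- the sequence is bounded in the sup norm
  have hbd : ∀ n, p n ∈ Metric.closedBall (0 : Fin 12 → EuclideanSpace ℝ (Fin 3)) 4 := by
    intro n
    rw [Metric.mem_closedBall, dist_zero_right, pi_norm_le_iff_of_nonneg (by norm_num)]
    intro i
    have h1 := ((hpQ n).1 i).2
    have h2 : (1 : ℝ) / ((n : ℝ) + 1) ≤ 1 := by
      rw [div_le_one (by positivity)]; linarith [n.cast_nonneg (α := ℝ)]
    linarith
  obtain ⟨q, -, φ, hφ, hlim⟩ := tendsto_subseq_of_bounded Metric.isBounded_closedBall hbd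
  have hδlim : Tendsto (fun n => (1 : ℝ) / (((φ n : ℕ) : ℝ) + 1)) atTop (𝓝 0) :=
    tendsto_one_div_add_atTop_nhds_zero_nat.comp hφ.tendsto_atTop
  obtain ⟨hinj, hK⟩ := kissing_of_limit (fun n => hpQ (φ n)) hδlim hlim
  -- pointwise convergence contradicts badness
  have hqi : ∀ i, Tendsto (fun n => p (φ n) i) atTop (𝓝 (q i)) := fun i =>
    (continuous_apply i).continuousAt.tendsto.comp hlim
  have hev : ∀ᶠ n in atTop, ∀ i, dist (p (φ n) i) (q i) ≤ ε := by
    rw [Filter.eventually_all]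
    intro i
    have : Tendsto (fun n => dist (p (φ n) i) (q i)) atTop (𝓝 0) := by
      rw [← dist_self (q i)]
      exact (hqi i).dist tendsto_const_nhds
    exact (this.eventually (ge_mem_nhds hε)).mono fun n hn => hn
  obtain ⟨n, hn⟩ := hev.exists
  obtain ⟨i, hi⟩ := hpbad (φ n) q hinj hK
  exact absurd (hn i) (not_le.2 hi)


/-! ## §C  Matching finite sets from matched tuples -/

/-- Two injective tuples that are pointwise `η`-close have `η`-matched images. -/
theorem etaMatched_of_tuples {η : ℝ} {f g : Fin 12 → EuclideanSpace ℝ (Fin 3)}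
    (hf : Function.Injective f) (hg : Function.Injective g) (h : ∀ i, dist (f i) (g i) ≤ η) :
    EtaMatched η (Finset.univ.image f) (Finset.univ.image g) := by
  classical
  have hTs : ∀ i, f i ∈ Finset.univ.image f := fun i => Finset.mem_image_of_mem f (Finset.mem_univ i)
  have hPs : ∀ i, g i ∈ Finset.univ.image g := fun i => Finset.mem_image_of_mem g (Finset.mem_univ i)
  let eT : Fin 12 → ↥(Finset.univ.image f) := fun i => ⟨f i, hTs i⟩
  let eP : Fin 12 → ↥(Finset.univ.image g) := fun i => ⟨g i, hPs i⟩
  have hTb : Function.Bijective eT := by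
    constructor
    · intro i j hij
      exact hf (by simpa [eT] using congrArg Subtype.val hij)
    · rintro ⟨x, hx⟩
      obtain ⟨i, -, rfl⟩ := Finset.mem_image.1 hx
      exact ⟨i, rfl⟩
  have hPb : Function.Bijective eP := by
    constructor
    · intro i j hij
      exact hg (by simpa [eP] using congrArg Subtype.val hij)
    · rintro ⟨x, hx⟩
      obtain ⟨i, -, rfl⟩ := Finset.mem_image.1 hx
      exact ⟨i, rfl⟩
  let ET := Equiv.ofBijective eT hTb
  let EP := Equiv.ofBijective eP hPb
  refine ⟨ET.symm.trans EP, fun t => ?_⟩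
  obtain ⟨i, rfl⟩ := ET.surjective t
  simp only [Equiv.trans_apply, Equiv.symm_apply_apply]
  show dist (f i) (g i) ≤ η
  exact h i

/-! ## §W  The registered stubs of item stmt-AtomisticToContinuum-30305 (skeleton `TightSomewhereRung_line_v2.lean`), BY NAME -/

/-- Registered stub `stub_twelveGap` of `TightSomewhereRung` (item 30305, skeleton v2) — = `twelve_gap` (rung G). -/
theorem stub_twelveGap (hL12 : Literature.Geometry.DiscreteGeometry.flyspeck_L12) (N : ℕ) (y : Fin N → EuclideanSpace ℝ (Fin 3)) (v : Fin N) (d δ : ℝ) (hd : 0 < d) (hδ0 : 0 ≤ δ) (hδ : δ < 1 / 50) (hsep : ∀ k l : Fin N, k ≠ l → dist (y k) (y v) ≤ 63 / 50 * d → dist (y l) (y v) ≤ 63 / 50 * d → d ≤ dist (y k) (y l)) (h12 : 12 ≤ (Finset.univ.filter fun l => l ≠ v ∧ dist (y l) (y v) ≤ (1 + δ) * d).card) : (Finset.univ.filter fun l => l ≠ v ∧ dist (y l) (y v) ≤ (1 + δ) * d).card = 12 ∧ ∀ w : Fin N, w ≠ v → dist (y w) (y v) ≤ (1 + δ) * d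 ∨ (63 / 50 - 12 * δ) * d ≤ dist (y w) (y v) :=
  twelve_gap hL12 y v hd hδ0 hδ hsep h12

/-- Registered stub `stub_kissingCompactness` of `TightSomewhereRung` (item 30305, skeleton v2) — = `kissing_compactness` (rung P). -/
theorem stub_kissingCompactness (ε : ℝ) (hε : 0 < ε) : ∃ δ : ℝ, 0 < δ ∧ ∀ p : Fin 12 → EuclideanSpace ℝ (Fin 3), ((∀ i, 2 ≤ ‖p i‖ ∧ ‖p i‖ ≤ 2 + 2 * δ) ∧ ∀ i j, i ≠ j → 2 ≤ dist (p i) (p j) ∧ (dist (p i) (p j) ≤ 2 + 2 * δ ∨ 2 * Literature.Geometry.DiscreteGeometry.hales_h0 - 24 * δ ≤ dist (p i) (p j))) → ∃ q : Fin 12 → EuclideanSpace ℝ (Fin 3), Function.Injective q ∧ Literature.Geometry.DiscreteGeometry.IsKissingConfig (Set.range q) ∧ ∀ i, dist (p i) (q i) ≤ ε :=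
  kissing_compactness hε

end Summit.AtomisticToContinuum.Crystallization.Theorems.ContactSaturationLadderQuasiTwelve
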